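import Summits.RiemannHypothesis.RiemannHypothesis.Theorems.OddSectorOddOneSignedWindowsLayerDefs
import Summits.RiemannHypothesis.RiemannHypothesis.Theorems.OddSectorOddArchAnchorMinimizer
import Literature.NumberTheory.LFunctions.WeilMarkovQuadratic
import Mathlib.Data.Real.Sign
import HarnessLib

set_option linter.dupNamespace false

/-!
# Fold of the prime increments (origin-layer line of `OddSector.OddOneSignedWindows`)

Stub `stub_foldPrimeIncrement` of the line `Sketch` of crux item stmt-RiemannHypothesis-17778
(RH-free, pure `L²` bookkeeping).

For a real `u ∈ L²(ℝ)` which is odd a.e. and `≥ 0` a.e. on `[η, ∞)`, and a jump length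
`ℓ ≥ η > 0`, write `ū(x) = sign(x) |u(x)|` for the antisymmetric fold, `u⁺ = max (Re u) 0`, and
`w = layerNegPart η u` (the negative part of `Re u` on the origin layer `(0, η)`; by the bulk sign
hypothesis it is a.e. the negative part of `Re u` on all of `(0, ∞)`). Pointwise,
`Δ(x) = |ū(x+ℓ) − ū(x)|² − |u(x+ℓ) − u(x)|²` equals `−2(|u(x+ℓ)u(x)| − u(x+ℓ)u(x)) ≤ 0` when `x` and
`x + ℓ` have the same sign (`x > 0` or `x < −ℓ`) and `+2(|u(x+ℓ)u(x)| + u(x+ℓ)u(x))` when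
`−ℓ < x < 0`; with `|AB| − AB = 2(A⁺B⁻ + A⁻B⁺)`, oddness and the substitutions `x ↦ −x − ℓ`,
`x ↦ −x`, `x ↦ x + ℓ` this gives

  `D_ℓ(ū) − D_ℓ(u) ≤ 8 ∫_{(0,η)} w(x) (u⁺(ℓ − x) − u⁺(ℓ + x)) dx`

(`D_t = weilIncrement`; reflected pairs `x + y = ℓ` lose, direct pairs `y − x = ℓ` gain). The proof
bounds `Δ` a.e. by the integrable density
`G(x) = −4 P(x) − 4 P(−x−ℓ) + 4 Q(−x) + 4 Q(x+ℓ)`, `P(x) = w(x) u⁺(x+ℓ)`, `Q(x) = w(x) u⁺(ℓ−x)`,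
and integrates (`∫ P(−x−ℓ) = ∫ P`, `∫ Q(−x) = ∫ Q(x+ℓ) = ∫ Q` by translation / reflection
invariance of Lebesgue measure).
-/

noncomputable section

open Complex Filter Set MeasureTheory
open scoped Real Topology ComplexConjugate ENNReal

namespace Summit.RiemannHypothesis.RiemannHypothesis.Theorems.OddSector

open Literature.NumberTheory.LFunctions
open Summit.RiemannHypothesis.RiemannHypothesis.Theorems.OddArchAnchor (memLp_signFold)

/-- Same-side pairs lose under the fold: `(|a| − |b|)² − (a − b)² = −2(|a||b| − ab) ≤ −4 b⁻ a⁺`.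
[folklore] -/
private theorem fold_sq_sub_le (a b : ℝ) :
    (|a| - |b|) ^ 2 - (a - b) ^ 2 ≤ -(4 * (max (-b) 0 * max a 0)) := by
  rcases le_total 0 a with ha | ha <;> rcases le_total 0 b with hb | hb
  · rw [abs_of_nonneg ha, abs_of_nonneg hb, max_eq_right (neg_nonpos.2 hb), max_eq_left ha]
    nlinarith
  · rw [abs_of_nonneg ha, abs_of_nonpos hb, max_eq_left (neg_nonneg.2 hb), max_eq_left ha]
    nlinarith
  · rw [abs_of_nonpos ha, abs_of_nonneg hb, max_eq_right (neg_nonpos.2 hb), max_eq_right ha]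
    nlinarith [mul_nonneg hb (neg_nonneg.2 ha)]
  · rw [abs_of_nonpos ha, abs_of_nonpos hb, max_eq_left (neg_nonneg.2 hb), max_eq_right ha]
    nlinarith

/-- Opposite-side pairs: `(|c| + |d|)² − (c + d)² = 2(|c||d| − cd) = 4(c⁺d⁻ + c⁻d⁺)`.
[folklore] -/
private theorem fold_sq_add_eq (c d : ℝ) :
    (|c| + |d|) ^ 2 - (c + d) ^ 2 = 4 * (max (-d) 0 * max c 0) + 4 * (max (-c) 0 * max d 0) := by
  rcases le_total 0 c with hc | hc <;> rcases le_total 0 d with hd | hd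
  · rw [abs_of_nonneg hc, abs_of_nonneg hd, max_eq_right (neg_nonpos.2 hd), max_eq_left hc,
      max_eq_right (neg_nonpos.2 hc), max_eq_left hd]
    ring
  · rw [abs_of_nonneg hc, abs_of_nonpos hd, max_eq_left (neg_nonneg.2 hd), max_eq_left hc,
      max_eq_right (neg_nonpos.2 hc), max_eq_right hd]
    ring
  · rw [abs_of_nonpos hc, abs_of_nonneg hd, max_eq_right (neg_nonpos.2 hd), max_eq_right hc,
      max_eq_left (neg_nonneg.2 hc), max_eq_left hd]
    ring
  · rw [abs_of_nonpos hc, abs_of_nonpos hd, max_eq_left (neg_nonneg.2 hd), max_eq_right hc,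
      max_eq_left (neg_nonneg.2 hc), max_eq_right hd]
    ring

/-- **Fold of the prime increments (RH-free, `L²` level).** For a real `u ∈ L²`, odd a.e. and
`≥ 0` a.e. on `[η, ∞)`, and a jump length `ℓ ≥ η > 0`, folding `u` to `sign · |u|` changes the
increment `D_ℓ` by at most `8 ∫_{(0,η)} w(x) (u⁺(ℓ − x) − u⁺(ℓ + x)) dx`, `w` the layer negative
part (reflected pairs `x + y = ℓ` lose, direct pairs `y − x = ℓ` gain). [folklore] -/
theorem stub_foldPrimeIncrement :
    ∀ (η ℓ : ℝ) (u : ℝ → ℂ), 0 < η → η ≤ ℓ → MemLp u 2 volume → (∀ t, (u t).im = 0) →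
      (∀ᵐ t : ℝ, u (-t) = -u t) → (∀ᵐ t : ℝ, η ≤ t → 0 ≤ (u t).re) →
      weilIncrement (fun x ↦ ((Real.sign x * ‖u x‖ : ℝ) : ℂ)) ℓ - weilIncrement u ℓ ≤
        8 * ∫ x in Ioo 0 η, (layerNegPart η u x).re *
          (max ((u (ℓ - x)).re) 0 - max ((u (ℓ + x)).re) 0) := by
  intro η ℓ u hη hηℓ hu2 him hodd hpos
  have hℓ : 0 < ℓ := hη.trans_le hηℓ
  /- `u` is real: `u = Re u`. -/
  have hre : ∀ y, (((u y).re : ℝ) : ℂ) = u y := fun y ↦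
    Complex.ext (by simp) (by simp [him y])
  have hnorm : ∀ y, ‖u y‖ = |(u y).re| := fun y ↦ by
    conv_lhs => rw [← hre y]
    rw [Complex.norm_real, Real.norm_eq_abs]
  have hdist : ∀ y z, ‖u y - u z‖ ^ 2 = ((u y).re - (u z).re) ^ 2 := fun y z ↦ by
    conv_lhs => rw [← hre y, ← hre z, ← Complex.ofReal_sub]
    rw [Complex.norm_real, Real.norm_eq_abs, sq_abs]
  have hfold : ∀ y z, ‖((Real.sign y * ‖u y‖ : ℝ) : ℂ) - ((Real.sign z * ‖u z‖ : ℝ) : ℂ)‖ ^ 2 =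
      (Real.sign y * |(u y).re| - Real.sign z * |(u z).re|) ^ 2 := fun y z ↦ by
    rw [← Complex.ofReal_sub, Complex.norm_real, Real.norm_eq_abs, sq_abs, hnorm, hnorm]
  /- the layer negative part `W` -/
  set W : ℝ → ℝ := fun x ↦ (layerNegPart η u x).re with hW_def
  have hW0 : ∀ x, x ∉ Ioo 0 η → W x = 0 := fun x hx ↦ by
    simp only [W, layerNegPart_eq_zero_of_notMem hx, Complex.zero_re]
  have hWmem : ∀ x, x ∈ Ioo 0 η → W x = max (-(u x).re) 0 := fun x hx ↦ by
    simp only [W, layerNegPart_eq_of_mem hx, Complex.ofReal_re]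
  /- measurability and square integrability -/
  have hf_meas : AEStronglyMeasurable (fun y ↦ (u y).re) volume :=
    Complex.continuous_re.comp_aestronglyMeasurable hu2.1
  have hf : MemLp (fun y ↦ (u y).re) 2 volume :=
    hu2.of_le hf_meas (Eventually.of_forall fun x ↦ by
      rw [Real.norm_eq_abs]; exact Complex.abs_re_le_norm _)
  have hFp : MemLp (fun y ↦ max ((u y).re) 0) 2 volume := by
    refine hf.of_le (hf_meas.sup aestronglyMeasurable_const) (Eventually.of_forall fun x ↦ ?_)
    rw [Real.norm_eq_abs, Real.norm_eq_abs, abs_of_nonneg (le_max_right _ _)]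
    exact max_le (le_abs_self _) (abs_nonneg _)
  have hWi : W = (Ioo 0 η).indicator fun y ↦ max (-(u y).re) 0 := by
    funext x
    simp [W, layerNegPart]
  have hW : MemLp W 2 volume := by
    refine hf.of_le ?_ (Eventually.of_forall fun x ↦ ?_)
    · rw [hWi]
      exact (hf_meas.neg.sup aestronglyMeasurable_const).indicator measurableSet_Ioo
    · rw [Real.norm_eq_abs, Real.norm_eq_abs]
      by_cases hx : x ∈ Ioo 0 η
      · rw [hWmem x hx, abs_of_nonneg (le_max_right _ _)]
        exact max_le (neg_le_abs _) (abs_nonneg _)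
      · rw [hW0 x hx, abs_zero]
        exact abs_nonneg _
  /- the two product densities and the dominating density -/
  set P : ℝ → ℝ := fun x ↦ W x * max ((u (x + ℓ)).re) 0 with hP_def
  set Q : ℝ → ℝ := fun x ↦ W x * max ((u (ℓ - x)).re) 0 with hQ_def
  have hPi : Integrable P volume :=
    hW.integrable_mul (hFp.comp_measurePreserving (measurePreserving_add_right volume ℓ))
  have hQi : Integrable Q volume :=
    hW.integrable_mul (hFp.comp_measurePreserving (Measure.measurePreserving_sub_left volume ℓ))
  have hP1 : Integrable (fun x ↦ P (-x - ℓ)) volume := (hPi.comp_sub_right ℓ).comp_neg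
  have hQ1 : Integrable (fun x ↦ Q (-x)) volume := hQi.comp_neg
  have hQ2 : Integrable (fun x ↦ Q (x + ℓ)) volume := hQi.comp_add_right ℓ
  set G : ℝ → ℝ := fun x ↦ -(4 * P x) - 4 * P (-x - ℓ) + 4 * Q (-x) + 4 * Q (x + ℓ) with hG_def
  have hGi : Integrable G volume :=
    ((((hPi.const_mul 4).neg.sub (hP1.const_mul 4)).add (hQ1.const_mul 4)).add (hQ2.const_mul 4))
  have hG_int : ∫ x, G x = -(8 * ∫ x, P x) + 8 * ∫ x, Q x := by
    have e1 : ∫ x, P (-x - ℓ) = ∫ x, P x := by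
      rw [integral_neg_eq_self (fun x ↦ P (x - ℓ)) volume]
      exact integral_sub_right_eq_self P ℓ
    have e2 : ∫ x, Q (-x) = ∫ x, Q x := integral_neg_eq_self Q volume
    have e3 : ∫ x, Q (x + ℓ) = ∫ x, Q x := integral_add_right_eq_self Q ℓ
    have i1 : Integrable (fun x ↦ -(4 * P x)) volume := (hPi.const_mul 4).neg
    have i2 : Integrable (fun x ↦ 4 * P (-x - ℓ)) volume := hP1.const_mul 4
    have i3 : Integrable (fun x ↦ 4 * Q (-x)) volume := hQ1.const_mul 4
    have i4 : Integrable (fun x ↦ 4 * Q (x + ℓ)) volume := hQ2.const_mul 4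
    have i12 : Integrable (fun x ↦ -(4 * P x) - 4 * P (-x - ℓ)) volume := i1.sub i2
    have i123 : Integrable (fun x ↦ -(4 * P x) - 4 * P (-x - ℓ) + 4 * Q (-x)) volume :=
      i12.add i3
    calc ∫ x, G x = ((∫ x, -(4 * P x)) - ∫ x, 4 * P (-x - ℓ)) + (∫ x, 4 * Q (-x)) +
          ∫ x, 4 * Q (x + ℓ) := by
          simp only [hG_def]
          rw [integral_add i123 i4, integral_add i12 i3, integral_sub i1 i2]
      _ = -(8 * ∫ x, P x) + 8 * ∫ x, Q x := by
          rw [integral_neg, integral_const_mul, integral_const_mul, integral_const_mul,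
            integral_const_mul, e1, e2, e3]
          ring
  /- the layer negative part is a.e. the negative part of `Re u` on `(0, ∞)` -/
  have hW_ae : ∀ᵐ x : ℝ, 0 < x → W x = max (-(u x).re) 0 := by
    filter_upwards [hpos] with x hx h0
    by_cases hxη : x < η
    · exact hWmem x ⟨h0, hxη⟩
    · rw [hW0 x (fun h ↦ hxη h.2), max_eq_right (neg_nonpos.2 (hx (not_lt.1 hxη)))]
  have hW_neg : ∀ᵐ x : ℝ, 0 < -x → W (-x) = max (-(u (-x)).re) 0 :=
    (Measure.measurePreserving_neg (volume : Measure ℝ)).quasiMeasurePreserving.ae hW_ae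
  have hW_add : ∀ᵐ x : ℝ, 0 < x + ℓ → W (x + ℓ) = max (-(u (x + ℓ))).re 0 :=
    (measurePreserving_add_right (volume : Measure ℝ) ℓ).quasiMeasurePreserving.ae hW_ae
  have hW_sub : ∀ᵐ x : ℝ, 0 < -x - ℓ → W (-x - ℓ) = max (-(u (-x - ℓ)).re) 0 :=
    (Measure.measurePreserving_neg (volume : Measure ℝ)).quasiMeasurePreserving.ae
      ((measurePreserving_sub_right (volume : Measure ℝ) ℓ).quasiMeasurePreserving.ae hW_ae)
  have hodd_add : ∀ᵐ x : ℝ, u (-(x + ℓ)) = -u (x + ℓ) :=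
    (measurePreserving_add_right (volume : Measure ℝ) ℓ).quasiMeasurePreserving.ae hodd
  have hne0 : ∀ᵐ x : ℝ, x ≠ 0 := by
    rw [ae_iff]
    simp
  have hneℓ : ∀ᵐ x : ℝ, x ≠ -ℓ := by
    rw [ae_iff]
    simp
  /- the a.e. pointwise bound `Δ ≤ G` -/
  have hΔG : ∀ᵐ x : ℝ,
      ‖((Real.sign (x + ℓ) * ‖u (x + ℓ)‖ : ℝ) : ℂ) - ((Real.sign x * ‖u x‖ : ℝ) : ℂ)‖ ^ 2 -
        ‖u (x + ℓ) - u x‖ ^ 2 ≤ G x := by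
    filter_upwards [hodd, hodd_add, hW_ae, hW_neg, hW_add, hW_sub, hne0, hneℓ] with x hox hoxℓ hWx
      hWnx hWxℓ hWnxℓ hx0 hxℓ
    rw [hfold, hdist, hG_def]
    simp only [hP_def, hQ_def]
    rcases lt_trichotomy x 0 with hneg | h0 | hpos
    · rcases lt_trichotomy (x + ℓ) 0 with hneg' | h0' | hpos'
      · -- region `x < -ℓ`: both points on the negative side
        rw [Real.sign_of_neg hneg', Real.sign_of_neg hneg, hW0 x (fun h ↦ by linarith [h.1]),
          hW0 (-x) (fun h ↦ by linarith [h.2]), hW0 (x + ℓ) (fun h ↦ by linarith [h.1]),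
          hWnxℓ (by linarith)]
        simp only [zero_mul, mul_zero, neg_zero, zero_sub, add_zero, sub_add_cancel]
        have hq : (u x).re = -(u (-x)).re := by rw [hox, Complex.neg_re, neg_neg]
        have hp : (u (x + ℓ)).re = -(u (-x - ℓ)).re := by
          rw [← neg_add', hoxℓ, Complex.neg_re, neg_neg]
        rw [hp, hq]
        calc (-1 * |-(u (-x - ℓ)).re| - -1 * |-(u (-x)).re|) ^ 2 -
              (-(u (-x - ℓ)).re - -(u (-x)).re) ^ 2
            = (|(u (-x)).re| - |(u (-x - ℓ)).re|) ^ 2 - ((u (-x)).re - (u (-x - ℓ)).re) ^ 2 := by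
              rw [abs_neg, abs_neg]; ring
          _ ≤ -(4 * (max (-(u (-x - ℓ)).re) 0 * max ((u (-x)).re) 0)) := fold_sq_sub_le _ _
      · exact absurd (eq_neg_of_add_eq_zero_left h0') hxℓ
      · -- region `-ℓ < x < 0`: the two points on opposite sides
        rw [Real.sign_of_pos hpos', Real.sign_of_neg hneg, one_mul,
          hW0 x (fun h ↦ by linarith [h.1]), hW0 (-x - ℓ) (fun h ↦ by linarith [h.1]),
          hWnx (by linarith), hWxℓ hpos']
        simp only [zero_mul, mul_zero, neg_zero, zero_sub, zero_add, sub_neg_eq_add,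
          sub_add_cancel_right]
        have hq : (u x).re = -(u (-x)).re := by rw [hox, Complex.neg_re, neg_neg]
        rw [hq, add_comm ℓ x]
        calc (|(u (x + ℓ)).re| - -1 * |-(u (-x)).re|) ^ 2 - ((u (x + ℓ)).re - -(u (-x)).re) ^ 2
            = (|(u (x + ℓ)).re| + |(u (-x)).re|) ^ 2 - ((u (x + ℓ)).re + (u (-x)).re) ^ 2 := by
              rw [abs_neg]; ring
          _ = 4 * (max (-(u (-x)).re) 0 * max ((u (x + ℓ)).re) 0) +
                4 * (max (-(u (x + ℓ)).re) 0 * max ((u (-x)).re) 0) := fold_sq_add_eq _ _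
          _ ≤ _ := le_rfl
    · exact absurd h0 hx0
    · -- region `x > 0`: both points on the positive side
      have hpos' : 0 < x + ℓ := add_pos hpos hℓ
      rw [Real.sign_of_pos hpos', Real.sign_of_pos hpos, one_mul, one_mul,
        hW0 (-x - ℓ) (fun h ↦ by linarith [h.1]), hW0 (-x) (fun h ↦ by linarith [h.1]),
        hW0 (x + ℓ) (fun h ↦ by linarith [h.2]), hWx hpos]
      simp only [zero_mul, mul_zero, sub_zero, add_zero]
      exact fold_sq_sub_le _ _
  /- assembly -/
  have hint1 : Integrable (fun x ↦ ‖((Real.sign (x + ℓ) * ‖u (x + ℓ)‖ : ℝ) : ℂ) -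
      ((Real.sign x * ‖u x‖ : ℝ) : ℂ)‖ ^ 2) volume :=
    integrable_weilIncrement_integrand (memLp_signFold hu2) ℓ
  have hint2 : Integrable (fun x ↦ ‖u (x + ℓ) - u x‖ ^ 2) volume :=
    integrable_weilIncrement_integrand hu2 ℓ
  have hP' : (fun x ↦ W x * max ((u (ℓ + x)).re) 0) = P := by
    funext x
    simp only [hP_def, add_comm]
  rw [weilIncrement, weilIncrement, ← integral_sub hint1 hint2,
    setIntegral_eq_integral_of_forall_compl_eq_zero (fun x hx ↦ by
      rw [layerNegPart_eq_zero_of_notMem hx, Complex.zero_re, zero_mul])]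
  calc ∫ x, (‖((Real.sign (x + ℓ) * ‖u (x + ℓ)‖ : ℝ) : ℂ) - ((Real.sign x * ‖u x‖ : ℝ) : ℂ)‖ ^ 2 -
        ‖u (x + ℓ) - u x‖ ^ 2) ≤ ∫ x, G x := integral_mono_ae (hint1.sub hint2) hGi hΔG
    _ = -(8 * ∫ x, P x) + 8 * ∫ x, Q x := hG_int
    _ = 8 * ∫ x, W x * (max ((u (ℓ - x)).re) 0 - max ((u (ℓ + x)).re) 0) := by
        simp only [mul_sub]
        rw [integral_sub hQi (by rw [hP']; exact hPi), hP']
        ring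

end Summit.RiemannHypothesis.RiemannHypothesis.Theorems.OddSector

end
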